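import Summits.BirchSwinnertonDyer.BirchSwinnertonDyer.Theorems.ClassRecordThreeEulerHalvesAtThreeCartanSupplyNormOneElliptic
import Summits.BirchSwinnertonDyer.BirchSwinnertonDyer.Theorems.ClassRecordThreeEulerHalvesAtThreeCartanSupplyVirtualSupply
import HarnessLib

/-!
# SUPPLY, the NORM-ONE count `Σ_g χ_W(g)² = |GL₂(𝔽_q)|`, part 4: the count

Helper file `--supports stmt-BirchSwinnertonDyer-19109 --as helper` (seat `bsd-idea-10` g13; crux `EulerHalvesAtThree` ∕ child 23422 line `cartan` v11,
stub SUPPLY). MAIN RESULT **`sum_sq_eq_card`**: for every prime `q ∉ {2, 3}`,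
  `Σ_{g ∈ GL₂(𝔽_q)} χ_W(g)² = |GL₂(𝔽_q)|`,
where `χ_W = cubicNewvectorChar q` is the explicit class function of the line (`q + 1 ∕ 1 ∕ 1 + #{cube roots of 1 among the eigenvalue ratio} ∕ 0`
for `q ≡ 1`, `q − 1 ∕ −1 ∕ 0 ∕ −(sum over cube roots)` for `q ≡ 2 (mod 3)`) — i.e. `⟨χ_W, χ_W⟩ = 1`: this is, verbatim, the statement of the node
`CubicNewvectorCharNormOne` (the hypothesis `hN` of `cartanTorusLatticeSupply_of_virtual`, helper chain IX; LEAD memo `SUPPLY-ROAD-GG1.md` §1).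
The proof enumerates NO conjugacy classes: with the type partition SCALAR ∕ PARABOLIC ∕ SPLIT REGULAR ∕ ELLIPTIC (§11, `sum_types`, `count_types`,
`|G| = q(q − 1)²(q + 1)`, tree `card_G` ∕ Mathlib `Matrix.card_GL_field`), `χ_W²` is `χ_W(1)²` ∕ `1` pointwise on the first two types and vanishes on the elliptic
(resp. split regular) type in the principal-series (resp. cuspidal) case (§12); the remaining type sum is read off the torus identities of parts 2–3
applied to `F = χ_W²`, using the torus sums `Σ_{T_s} χ_W² = (q − 1)((q + 1)² + 2(q − 3))` and `Σ_{T_C} χ_W² = (q − 1)²(q + 1)` (§13, from the tree's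
torus restrictions `char_diagGL_mirabolic`, `char_nonsplitTorus`, `card_cubeRoots`, `nonsplitCubes_card`); §14 is the linear elimination; §15 records the node `CubicNewvectorCharNormOne` BY NAME and the corollary
`cartanTorusLatticeSupply_of_virtualRealisation : CubicNewvectorCharVirtual → CartanTorusLatticeSupply` (SUPPLY from the virtual realisation alone).
HONEST FRAMING: this proves the counting identity NORM ONE only; the VIRTUAL REALISATION node, NUM, crux 23422 ∕ 19109 and every summit statement remain
open; nothing here is a statement about elliptic curves; BSD is proved for no curve. [folklore]
-/

set_option linter.dupNamespace false
set_option autoImplicit false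

noncomputable section

namespace Summit.BirchSwinnertonDyer.BirchSwinnertonDyer.Theorems.CartanSupply.NormOne

open Summit.BirchSwinnertonDyer.BirchSwinnertonDyer.Theorems.CartanDegree
open Summit.BirchSwinnertonDyer.BirchSwinnertonDyer.Theorems.CartanTorusCubeCut
open Summit.BirchSwinnertonDyer.BirchSwinnertonDyer.Theorems.CartanCorrespondence
open scoped Classical

variable {q : ℕ} [Fact q.Prime]

/-! ## §11 The order of `GL₂(𝔽_q)` and the type partition -/

/-- PROVED: `|GL₂(𝔽_q)| = q(q − 1)²(q + 1)` as an integer (tree `card_G`, from Mathlib `Matrix.card_GL_field`). [folklore] -/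
theorem card_G_int : (Fintype.card (G q) : ℤ) = (q : ℤ) * ((q : ℤ) - 1) ^ 2 * ((q : ℤ) + 1) := by
  have hq : q.Prime := Fact.out
  rw [← Nat.card_eq_fintype_card, card_G]
  have h1 : 1 ≤ q ^ 2 := Nat.one_le_pow _ _ hq.pos
  have h2 : q ≤ q ^ 2 := Nat.le_self_pow two_ne_zero q
  rw [Nat.cast_mul, Nat.cast_sub h1, Nat.cast_sub h2]
  push_cast
  ring

/-- PROVED (`q` odd): `Δ = 0` forces a rational eigenvalue (`tr/2`). [folklore] -/
theorem hasRatEigenvalue_of_discr_eq_zero (hq2 : q ≠ 2) {M : Mat q} (hΔ : M.trace ^ 2 - 4 * M.det = 0) : HasRatEigenvalue M := by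
  rw [FixedPoints.hasRatEigenvalue_iff_isSquare_discr ((ManinLocalTwoThree.SL2ZModOddPrime.neZero_two hq2).out), hΔ]
  exact IsSquare.zero

/-- PROVED — **THE TYPE PARTITION** (`q` odd): every element is exactly one of SCALAR, PARABOLIC (`Δ = 0`, non-scalar), SPLIT REGULAR
(rational eigenvalue, `Δ ≠ 0`), ELLIPTIC (no rational eigenvalue); sums split accordingly. [folklore] -/
theorem sum_types (hq2 : q ≠ 2) (f : G q → ℤ) :
    ∑ g, f g =
      ∑ g ∈ Finset.univ.filter (fun g : G q => IsScalarMat (g : Mat q)), f g +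
      ∑ g ∈ Finset.univ.filter (fun g : G q => ¬ IsScalarMat (g : Mat q) ∧ (g : Mat q).trace ^ 2 - 4 * (g : Mat q).det = 0), f g +
      ∑ g ∈ Finset.univ.filter (fun g : G q => HasRatEigenvalue (g : Mat q) ∧ (g : Mat q).trace ^ 2 - 4 * (g : Mat q).det ≠ 0), f g +
      ∑ g ∈ Finset.univ.filter (fun g : G q => ¬ HasRatEigenvalue (g : Mat q)), f g := by
  rw [Finset.sum_filter, Finset.sum_filter, Finset.sum_filter, Finset.sum_filter, ← Finset.sum_add_distrib, ← Finset.sum_add_distrib,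
    ← Finset.sum_add_distrib]
  refine Finset.sum_congr rfl (fun g _ => ?_)
  by_cases hs : IsScalarMat (g : Mat q)
  · have hΔ : (g : Mat q).trace ^ 2 - 4 * (g : Mat q).det = 0 := PS.discr_eq_zero_of_isScalar hs
    have hr : HasRatEigenvalue (g : Mat q) := hasRatEigenvalue_of_isScalarMat hs
    have hP : ¬ (¬ IsScalarMat (g : Mat q) ∧ (g : Mat q).trace ^ 2 - 4 * (g : Mat q).det = 0) := fun h => h.1 hs
    have hR : ¬ (HasRatEigenvalue (g : Mat q) ∧ (g : Mat q).trace ^ 2 - 4 * (g : Mat q).det ≠ 0) := fun h => h.2 hΔ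
    rw [if_pos hs, if_neg hP, if_neg hR, if_neg (not_not.2 hr)]; ring
  · by_cases hΔ : (g : Mat q).trace ^ 2 - 4 * (g : Mat q).det = 0
    · have hr : HasRatEigenvalue (g : Mat q) := hasRatEigenvalue_of_discr_eq_zero hq2 hΔ
      have hR : ¬ (HasRatEigenvalue (g : Mat q) ∧ (g : Mat q).trace ^ 2 - 4 * (g : Mat q).det ≠ 0) := fun h => h.2 hΔ
      rw [if_neg hs, if_pos ⟨hs, hΔ⟩, if_neg hR, if_neg (not_not.2 hr)]; ring
    · by_cases hr : HasRatEigenvalue (g : Mat q)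
      · have hP : ¬ (¬ IsScalarMat (g : Mat q) ∧ (g : Mat q).trace ^ 2 - 4 * (g : Mat q).det = 0) := fun h => hΔ h.2
        rw [if_neg hs, if_neg hP, if_pos ⟨hr, hΔ⟩, if_neg (not_not.2 hr)]; ring
      · have hP : ¬ (¬ IsScalarMat (g : Mat q) ∧ (g : Mat q).trace ^ 2 - 4 * (g : Mat q).det = 0) := fun h => hΔ h.2
        have hR : ¬ (HasRatEigenvalue (g : Mat q) ∧ (g : Mat q).trace ^ 2 - 4 * (g : Mat q).det ≠ 0) := fun h => hr h.1
        rw [if_neg hs, if_neg hP, if_neg hR, if_pos hr]; ring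

/-- PROVED: the element count of the type partition: `|G| = (q − 1) + #parabolic + #split regular + #elliptic`. [folklore] -/
theorem count_types (hq2 : q ≠ 2) :
    (Fintype.card (G q) : ℤ) = ((q : ℤ) - 1) +
      ((Finset.univ.filter fun g : G q => ¬ IsScalarMat (g : Mat q) ∧ (g : Mat q).trace ^ 2 - 4 * (g : Mat q).det = 0).card : ℤ) +
      ((Finset.univ.filter fun g : G q => HasRatEigenvalue (g : Mat q) ∧ (g : Mat q).trace ^ 2 - 4 * (g : Mat q).det ≠ 0).card : ℤ) +
      ((Finset.univ.filter fun g : G q => ¬ HasRatEigenvalue (g : Mat q)).card : ℤ) := by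
  have hq1 : ((q - 1 : ℕ) : ℤ) = (q : ℤ) - 1 := by
    rw [Nat.cast_sub (Fact.out : q.Prime).one_le]; simp
  have h := sum_types hq2 (fun _ : G q => (1 : ℤ))
  simp only [Finset.sum_const, Finset.card_univ, nsmul_eq_mul, mul_one, card_scalar, hq1] at h
  exact h

/-! ## §12 `χ_W²` pointwise by type -/

omit [Fact q.Prime] in
/-- PROVED: `χ_W(z) = χ_W(1)` on scalars, and `χ_W(1) = q + 1` (`q ≡ 1`) resp. `q − 1` (`q ≢ 1 (mod 3)`). [folklore] -/
theorem char_one_eq : cubicNewvectorChar q 1 = if q % 3 = 1 then (q : ℤ) + 1 else (q : ℤ) - 1 := by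
  unfold cubicNewvectorChar
  rw [Units.val_one]
  exact PS.charMat_of_isScalar PS.isScalarMat_one

/-- PROVED: `Σ_{g scalar} χ_W(g)² = (q − 1)·χ_W(1)²`. [folklore] -/
theorem sum_sq_scalar :
    ∑ g ∈ Finset.univ.filter (fun g : G q => IsScalarMat (g : Mat q)), cubicNewvectorChar q g ^ 2 =
      ((q : ℤ) - 1) * cubicNewvectorChar q 1 ^ 2 := by
  have hq1 : ((q - 1 : ℕ) : ℤ) = (q : ℤ) - 1 := by
    rw [Nat.cast_sub (Fact.out : q.Prime).one_le]; simp
  rw [Finset.sum_congr rfl (fun g hg => by rw [PS.char_of_isScalar (Finset.mem_filter.1 hg).2]), Finset.sum_const, card_scalar,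
    nsmul_eq_mul, hq1]

/-- PROVED: `χ_W(g)² = 1` on PARABOLIC `g` (`χ_W = 1` resp. `−1`). [folklore] -/
theorem char_sq_parabolic {g : G q} (hns : ¬ IsScalarMat (g : Mat q)) (hΔ : (g : Mat q).trace ^ 2 - 4 * (g : Mat q).det = 0) :
    cubicNewvectorChar q g ^ 2 = 1 := by
  unfold cubicNewvectorChar cubicNewvectorCharMat
  simp only [hΔ, hns, if_true, if_false]
  split_ifs <;> norm_num

/-- PROVED: `Σ_{g parabolic} χ_W(g)² = #parabolic`. [folklore] -/
theorem sum_sq_parabolic :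
    ∑ g ∈ Finset.univ.filter (fun g : G q => ¬ IsScalarMat (g : Mat q) ∧ (g : Mat q).trace ^ 2 - 4 * (g : Mat q).det = 0),
        cubicNewvectorChar q g ^ 2 =
      ((Finset.univ.filter fun g : G q => ¬ IsScalarMat (g : Mat q) ∧ (g : Mat q).trace ^ 2 - 4 * (g : Mat q).det = 0).card : ℤ) := by
  rw [Finset.sum_congr rfl (fun g hg => char_sq_parabolic (Finset.mem_filter.1 hg).2.1 (Finset.mem_filter.1 hg).2.2), Finset.sum_const,
    nsmul_eq_mul, mul_one]

/-- PROVED: `χ_W = 0` on elliptic elements in the principal-series case. [folklore] -/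
theorem sum_sq_elliptic_ps (h1 : q % 3 = 1) :
    ∑ g ∈ Finset.univ.filter (fun g : G q => ¬ HasRatEigenvalue (g : Mat q)), cubicNewvectorChar q g ^ 2 = 0 := by
  refine Finset.sum_eq_zero (fun g hg => ?_)
  have h : cubicNewvectorChar q g = 0 := PS.charMat_elliptic h1 (Finset.mem_filter.1 hg).2
  rw [h]; norm_num

/-- PROVED: `χ_W = 0` on split regular elements in the cuspidal case. [folklore] -/
theorem sum_sq_split_cusp (h3 : q % 3 = 2) :
    ∑ g ∈ Finset.univ.filter (fun g : G q => HasRatEigenvalue (g : Mat q) ∧ (g : Mat q).trace ^ 2 - 4 * (g : Mat q).det ≠ 0),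
      cubicNewvectorChar q g ^ 2 = 0 := by
  refine Finset.sum_eq_zero (fun g hg => ?_)
  obtain ⟨hr, hΔ⟩ := (Finset.mem_filter.1 hg).2
  have h1 : ¬ q % 3 = 1 := by omega
  have h : cubicNewvectorChar q g = 0 := by
    unfold cubicNewvectorChar cubicNewvectorCharMat
    simp only [h1, if_false, hΔ, hr, if_true]
  rw [h]; norm_num

omit [Fact q.Prime] in
/-- PROVED: `χ_W²` is a class function. [folklore] -/
theorem char_sq_comm (a b : G q) : cubicNewvectorChar q (a * b) ^ 2 = cubicNewvectorChar q (b * a) ^ 2 := by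
  have h : a * b = a * (b * a) * a⁻¹ := by group
  rw [h, PS.char_conj]

/-! ## §13 `Σ χ_W²` over the tori -/

/-- PROVED (`q ≡ 1 (mod 3)`): `Σ_{a} χ_W(diag(a,1))² = (q + 1)² + 2(q − 3)`. [folklore] -/
theorem sum_sq_mirabolic (h1 : q % 3 = 1) :
    ∑ a : (ZMod q)ˣ, cubicNewvectorChar q (diagGL ![a, 1]) ^ 2 = ((q : ℤ) + 1) ^ 2 + 2 * ((q : ℤ) - 3) := by
  have hq : q.Prime := Fact.out
  have hsplit : ∀ a : (ZMod q)ˣ, cubicNewvectorChar q (diagGL ![a, 1]) ^ 2 =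
      (3 * (if (a : ZMod q) ^ ((q - 1) / 3) = 1 then 1 else 0) + 1) + (if a = 1 then ((q : ℤ) + 1) ^ 2 - 4 else 0) := by
    intro a
    rw [PS.char_diagGL_mirabolic h1 a]
    by_cases ha : a = 1
    · subst ha; simp
    · simp only [ha, if_false, add_zero]
      split_ifs <;> norm_num
  simp_rw [hsplit]
  rw [Finset.sum_add_distrib, Finset.sum_ite_eq' Finset.univ (1 : (ZMod q)ˣ), if_pos (Finset.mem_univ _),
    Finset.sum_add_distrib, ← Finset.mul_sum, Finset.sum_boole, Finset.sum_const, Finset.card_univ,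
    ZMod.card_units, PS.card_cubeRoots h1]
  simp only [nsmul_eq_mul, mul_one]
  have h3 : (((q - 1) / 3 : ℕ) : ℤ) * 3 = ((q - 1 : ℕ) : ℤ) := by exact_mod_cast (by omega : (q - 1) / 3 * 3 = q - 1)
  have hq1 : ((q - 1 : ℕ) : ℤ) = (q : ℤ) - 1 := by
    rw [Nat.cast_sub hq.one_le]; simp
  linear_combination h3 + 2 * hq1

/-- PROVED (`q ≡ 1 (mod 3)`) — **`Σ_{t ∈ T_s} χ_W(t)² = (q − 1)·((q + 1)² + 2(q − 3))`**. [folklore] -/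
theorem sum_sq_splitTorus (h1 : q % 3 = 1) :
    ∑ t ∈ splitTorus q, cubicNewvectorChar q t ^ 2 = ((q : ℤ) - 1) * (((q : ℤ) + 1) ^ 2 + 2 * ((q : ℤ) - 3)) := by
  have hq1 : ((q - 1 : ℕ) : ℤ) = (q : ℤ) - 1 := by
    rw [Nat.cast_sub (Fact.out : q.Prime).one_le]; simp
  rw [splitTorus_eq_image, Finset.sum_image (fun u _ v _ h => diagGL_injective h)]
  let e : (Fin 2 → (ZMod q)ˣ) ≃ (ZMod q)ˣ × (ZMod q)ˣ :=
    ⟨fun u => (u 0 * (u 1)⁻¹, u 1), fun p => ![p.1 * p.2, p.2],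
      fun u => by funext i; fin_cases i <;> simp, fun p => by simp⟩
  calc ∑ u : Fin 2 → (ZMod q)ˣ, cubicNewvectorChar q (diagGL u) ^ 2
      = ∑ u : Fin 2 → (ZMod q)ˣ, cubicNewvectorChar q (diagGL ![(e u).1, 1]) ^ 2 :=
        Finset.sum_congr rfl fun u _ => by rw [PS.char_diagGL_eq h1 u]; rfl
    _ = ∑ p : (ZMod q)ˣ × (ZMod q)ˣ, cubicNewvectorChar q (diagGL ![p.1, 1]) ^ 2 :=
        Fintype.sum_equiv e _ (fun p => cubicNewvectorChar q (diagGL ![p.1, 1]) ^ 2) (fun _ => rfl)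
    _ = ∑ a : (ZMod q)ˣ, ∑ _b : (ZMod q)ˣ, cubicNewvectorChar q (diagGL ![a, 1]) ^ 2 := Fintype.sum_prod_type _
    _ = ((q : ℤ) - 1) * (((q : ℤ) + 1) ^ 2 + 2 * ((q : ℤ) - 3)) := by
        rw [← sum_sq_mirabolic h1, Finset.mul_sum]
        refine Finset.sum_congr rfl fun a _ => ?_
        rw [Finset.sum_const, Finset.card_univ, ZMod.card_units, nsmul_eq_mul, hq1]

/-- PROVED (`q ≡ 2 (mod 3)`) — **`Σ_{t ∈ T_C} χ_W(t)² = (q − 1)²(q + 1)`** (tree `char_nonsplitTorus`: `q − 1` on scalars, `−2` on non-scalar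
cubes, `1` off the cubes). [folklore] -/
theorem sum_sq_nonsplitTorus {η : Mat q} (hη : ¬ HasRatEigenvalue η) (hq5 : 5 ≤ q) (hq3 : q % 3 = 2) :
    ∑ t ∈ nonsplitTorus η, cubicNewvectorChar q t ^ 2 = ((q : ℤ) - 1) ^ 2 * ((q : ℤ) + 1) := by
  have hq1 : ((q - 1 : ℕ) : ℤ) = (q : ℤ) - 1 := by
    rw [Nat.cast_sub (Fact.out : q.Prime).one_le]; simp
  have hpt : ∀ t ∈ nonsplitTorus η, cubicNewvectorChar q t ^ 2 =
      1 + 3 * (if t ∈ nonsplitCubes η then 1 else 0) + (((q : ℤ) - 1) ^ 2 - 4) * (if IsScalarMat (t : Mat q) then 1 else 0) := by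
    intro t ht
    rw [char_nonsplitTorus hη hq5 hq3 ht]
    by_cases hs : IsScalarMat (t : Mat q)
    · have hc := scalar_mem_nonsplitCubes hη hq5 hq3 ht hs
      rw [if_pos hc, if_pos hs]; ring
    · rw [if_neg hs]
      split_ifs <;> norm_num
  rw [Finset.sum_congr rfl hpt, Finset.sum_add_distrib, Finset.sum_add_distrib, ← Finset.mul_sum, ← Finset.mul_sum, Finset.sum_boole,
    Finset.sum_boole, Finset.sum_const, Finset.filter_mem_eq_inter, Finset.inter_eq_right.2 (fun t ht => nonsplitCubes_subset η ht),
    card_scalar_nonsplitTorus hη, nonsplitTorus_card hη]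
  have h3 := nonsplitCubes_card hη hq5
  have h3' : (3 : ℤ) * ((nonsplitCubes η).card : ℤ) = ((q : ℤ) - 1) * ((q : ℤ) + 1) := by
    have := congrArg (fun n : ℕ => (n : ℤ)) h3
    push_cast [Nat.cast_sub (Fact.out : q.Prime).one_le] at this
    linear_combination this
  simp only [nsmul_eq_mul, mul_one, Nat.cast_mul, hq1]
  push_cast
  linear_combination h3'

/-! ## §14 NORM ONE: `Σ_g χ_W(g)² = |GL₂(𝔽_q)|` -/

/-- PROVED — **NORM ONE, principal-series case** (`q ≡ 1 (mod 3)`). [folklore] -/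
theorem sum_sq_eq_card_ps (h1 : q % 3 = 1) : ∑ g : G q, cubicNewvectorChar q g ^ 2 = Fintype.card (G q) := by
  have hq : q.Prime := Fact.out
  have hq2 : q ≠ 2 := by rintro rfl; simp at h1
  -- the ingredients
  have hsum := sum_types hq2 (fun g : G q => cubicNewvectorChar q g ^ 2)
  have hSval := sum_sq_scalar (q := q)
  rw [char_one_eq, if_pos h1] at hSval
  have hPval := sum_sq_parabolic (q := q)
  have hE := sum_sq_elliptic_ps h1
  have hT := splitTorus_identity (q := q) (fun g => cubicNewvectorChar q g ^ 2) char_sq_comm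
  have hTval := sum_sq_splitTorus h1
  have hb := count_split (q := q)
  have hc := count_elliptic hq2
  have hcnt := count_types hq2
  have hN := card_G_int (q := q)
  -- eliminate
  have hRsum : 2 * ((q : ℤ) - 1) ^ 2 *
      ∑ g ∈ Finset.univ.filter (fun g : G q => HasRatEigenvalue (g : Mat q) ∧ (g : Mat q).trace ^ 2 - 4 * (g : Mat q).det ≠ 0),
        cubicNewvectorChar q g ^ 2 = 2 * (Fintype.card (G q) : ℤ) * ((q : ℤ) - 1) * ((q : ℤ) - 3) := by
    linear_combination (-1 : ℤ) * hT + (Fintype.card (G q) : ℤ) * hTval - (Fintype.card (G q) : ℤ) * hSval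
  have hK : (2 : ℤ) * ((q : ℤ) - 1) ^ 2 * ((q : ℤ) + 1) ≠ 0 := by
    have h1' : (q : ℤ) - 1 ≠ 0 := by have := hq.two_le; omega
    have h2' : (q : ℤ) + 1 ≠ 0 := by have := hq.two_le; omega
    exact mul_ne_zero (mul_ne_zero two_ne_zero (pow_ne_zero 2 h1')) h2'
  have key : (2 : ℤ) * ((q : ℤ) - 1) ^ 2 * ((q : ℤ) + 1) * ∑ g : G q, cubicNewvectorChar q g ^ 2 =
      (2 : ℤ) * ((q : ℤ) - 1) ^ 2 * ((q : ℤ) + 1) * (Fintype.card (G q) : ℤ) := by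
    linear_combination (2 * ((q : ℤ) - 1) ^ 2 * ((q : ℤ) + 1)) * hsum + (2 * ((q : ℤ) - 1) ^ 2 * ((q : ℤ) + 1)) * hSval +
      (2 * ((q : ℤ) - 1) ^ 2 * ((q : ℤ) + 1)) * hPval + (2 * ((q : ℤ) - 1) ^ 2 * ((q : ℤ) + 1)) * hE +
      ((q : ℤ) + 1) * hRsum - ((q : ℤ) + 1) * hb - ((q : ℤ) - 1) * hc - (2 * ((q : ℤ) - 1) ^ 2 * ((q : ℤ) + 1)) * hcnt -
      2 * ((q : ℤ) - 1) * ((q : ℤ) + 2) * hN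
  exact mul_left_cancel₀ hK key

/-- PROVED — **NORM ONE, cuspidal case** (`q ≡ 2 (mod 3)`, `q ≥ 5`). [folklore] -/
theorem sum_sq_eq_card_cusp (hq5 : 5 ≤ q) (h3 : q % 3 = 2) : ∑ g : G q, cubicNewvectorChar q g ^ 2 = Fintype.card (G q) := by
  have hq : q.Prime := Fact.out
  have hq2 : q ≠ 2 := by omega
  obtain ⟨η, hη⟩ := exists_not_hasRatEigenvalue hq2
  have hsum := sum_types hq2 (fun g : G q => cubicNewvectorChar q g ^ 2)
  have hSval := sum_sq_scalar (q := q)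
  rw [char_one_eq, if_neg (by omega : ¬ q % 3 = 1)] at hSval
  have hPval := sum_sq_parabolic (q := q)
  have hR0 := sum_sq_split_cusp h3
  have hC := nonsplitTorus_identity hq2 hη (fun g => cubicNewvectorChar q g ^ 2) char_sq_comm
  have hCval := sum_sq_nonsplitTorus hη hq5 h3
  have hb := count_split (q := q)
  have hc := count_elliptic hq2
  have hcnt := count_types hq2
  have hN := card_G_int (q := q)
  have hEsum : 2 * (((q : ℤ) - 1) * ((q : ℤ) + 1)) *
      ∑ g ∈ Finset.univ.filter (fun g : G q => ¬ HasRatEigenvalue (g : Mat q)), cubicNewvectorChar q g ^ 2 =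
        2 * (Fintype.card (G q) : ℤ) * ((q : ℤ) - 1) ^ 2 := by
    linear_combination (-1 : ℤ) * hC + (Fintype.card (G q) : ℤ) * hCval - (Fintype.card (G q) : ℤ) * hSval
  have hK : (2 : ℤ) * ((q : ℤ) - 1) ^ 2 * ((q : ℤ) + 1) ≠ 0 := by
    have h1' : (q : ℤ) - 1 ≠ 0 := by omega
    have h2' : (q : ℤ) + 1 ≠ 0 := by omega
    exact mul_ne_zero (mul_ne_zero two_ne_zero (pow_ne_zero 2 h1')) h2'
  have key : (2 : ℤ) * ((q : ℤ) - 1) ^ 2 * ((q : ℤ) + 1) * ∑ g : G q, cubicNewvectorChar q g ^ 2 =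
      (2 : ℤ) * ((q : ℤ) - 1) ^ 2 * ((q : ℤ) + 1) * (Fintype.card (G q) : ℤ) := by
    linear_combination (2 * ((q : ℤ) - 1) ^ 2 * ((q : ℤ) + 1)) * hsum + (2 * ((q : ℤ) - 1) ^ 2 * ((q : ℤ) + 1)) * hSval +
      (2 * ((q : ℤ) - 1) ^ 2 * ((q : ℤ) + 1)) * hPval + (2 * ((q : ℤ) - 1) ^ 2 * ((q : ℤ) + 1)) * hR0 +
      ((q : ℤ) - 1) * hEsum - ((q : ℤ) + 1) * hb - ((q : ℤ) - 1) * hc - (2 * ((q : ℤ) - 1) ^ 2 * ((q : ℤ) + 1)) * hcnt -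
      2 * ((q : ℤ) - 1) * ((q : ℤ) - 2) * hN
  exact mul_left_cancel₀ hK key

/-- PROVED — **NORM ONE** for every prime `q ∉ {2, 3}`: `Σ_{g ∈ GL₂(𝔽_q)} χ_W(g)² = |GL₂(𝔽_q)|`, i.e. `⟨χ_W, χ_W⟩ = 1`. [folklore] -/
theorem sum_sq_eq_card (h3 : q ≠ 3) (h2 : q ≠ 2) : ∑ g : G q, cubicNewvectorChar q g ^ 2 = Fintype.card (G q) := by
  have hq : q.Prime := Fact.out
  rcases prime_mod_three hq h3 with h1 | h1
  · exact sum_sq_eq_card_ps h1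
  · have hq5 : 5 ≤ q := by
      have := hq.two_le
      omega
    exact sum_sq_eq_card_cusp hq5 h1


/-! ## §15 The node `CubicNewvectorCharNormOne`; SUPPLY from the virtual realisation alone -/

/-- PROVED — the node **`CubicNewvectorCharNormOne`** of the virtual-character engine (`…CartanSupplyVirtualSupply`), BY NAME. [folklore] -/
theorem cubicNewvectorCharNormOne : CubicNewvectorCharNormOne := by
  intro q _ h3 h2
  exact sum_sq_eq_card h3 h2

/-- PROVED — **CONVOLUTION SUPPLY ⟸ VIRTUAL REALISATION alone**. [folklore] -/
theorem cartanConvolutionSupply_of_virtualRealisation (hV : CubicNewvectorCharVirtual) : CartanConvolutionSupply :=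
  cartanConvolutionSupply_of_virtual cubicNewvectorCharNormOne hV

/-- PROVED — **SUPPLY ⟸ VIRTUAL REALISATION alone**: `CubicNewvectorCharVirtual → CartanTorusLatticeSupply` (the v11 stub SUPPLY of 23422's line
`cartan`, BY NAME; the remaining input is the LINE OWNER's realisation of `χ_W` as a difference of two honest `ℚ`-representations). [folklore] -/
theorem cartanTorusLatticeSupply_of_virtualRealisation (hV : CubicNewvectorCharVirtual) : CartanTorusLatticeSupply :=
  cartanTorusLatticeSupply_of_virtual cubicNewvectorCharNormOne hV

end Summit.BirchSwinnertonDyer.BirchSwinnertonDyer.Theorems.CartanSupply.NormOne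

end
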